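import Summits.QuantumFields.YangMills.Theorems.BalabanUVNodesN18TransportedPairFactorisationLetters
import HarnessLib

/-!
# BalabanUVNodes ∕ node N18 = NE5 — closure-ledger item (iii): THE C⁰ FACTORISATION OF THE TRANSPORTED PAIR OVER THE AVERAGED FACTOR AT THE FRAMES OF RECORD —
# `Ū = (exp iξ′A′)·U_A` with `U_A = fieldShift (avgUnits U)`, `A′ = (iξ′)⁻¹ log(Ū·U_A⁻¹)` TRACELESS, `|A′| ≤ 2ρ∕ξ′`, crude `|∇_{U_A}A′| ≤ 4ρ∕ξ′²`, packaged with
# CONDITION (i) one run up (FILE E) as the first block of FILE 7's `hletters`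
# (Track A, DAG node N18 = `T4OutputRate.NE5` :211; cluster K4 «SpineRates», item K3⁷ `SpineGivenEndpointR13SepCoPH`; seat pub-ymgap-dag-n18-w3 g4)

HONEST FRAMING.  Count-neutral kernel bookkeeping (`--supports stmt-QuantumFields-20544 --as helper`): composition BY NAME of the sibling `…N18TransportedPairFactorisationLetters`
(§1–§2 letters), FILE B's `hUGc` (`det Ū = 1`), FILE D (`U_A ∈ SU(N)`), FILE E (condition (i) for `U_A`).  This gives the `Factors`, `CondI`, `A′ ∈ 𝔤ᶜ`, `|A′| ≤ a` and a CRUDE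
`|∇_{U_A}A′| ≤ a₁` conjunct of FILE 7's `hletters` for the candidate factor — the C⁰ half of [Balaban1985Averaging] Proposition 3 at crude constants (`a = O(α₁ + Lα₀ξ)`,
`a₁ = 2a∕η_j`).  The plaquette letter of the COMPLEX `Ū`, the comb generator `l` and the cancelled sums `s₀, s₁` are NOT here.  Nothing of Bałaban's renormalization group is
asserted; NE5 NOT PRINTED ∕ NOT proved; N18 NOT discharged; nothing about the continuum ∕ OS ∕ mass gap ∕ Clay.

WHAT.
* ★★★ `exists_factors_TΦOfRecord` — for `Y ∈ 𝐃_j` of run A and `Φ` with `Φ.U = (exp iξA′)·U`, (i) for `U`, (ii) for `A′` on `frameI Rz M (j+1) (domSites π(j,Y))` and `ξ′ > 0`: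
  there are `U_A, A′_A` with `Ū(b) = exp iξ′A′_A(b)·U_A(b)` at EVERY bond and, on the bonds of `regionOfSet (domSites Y)`, `U_A = fieldShift (avgUnits U)`,
  `A′_A = (iξ′)⁻¹ log(Ū·U_A⁻¹)`, `tr A′_A = 0`, `‖A′_A‖ ≤ 2ρ∕ξ′` (`ρ = 22·(r + ((1+4ξα₁)^ℓ − 1))`; off those bonds `U_A := Ū`, `A′_A := 0`).
* ★★★★ `exists_factors_condI_TΦOfRecord` — at `ξ′ = η_j` (run A's `StepConsts.ofParams`): `Factors ∧ CondI (suModel N) (frameI RzA M j (domSites Y)) (StepConsts.ofParams (F.P k) cA j) α₀A U_A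
  ∧ (U_A = fieldShift (avgUnits U), A′_A = (iη_j)⁻¹ log(Ū·U_A⁻¹) on the frame bonds) ∧ (A′_A ∈ 𝔰𝔩(N,ℂ)) ∧ (‖A′_A‖ ≤ 2ρ∕η_j) ∧ (‖∇^{η_j}_{U_A}A′_A‖ ≤ 2·(2ρ∕η_j)∕η_j)` on the
  frame, under the displayed numerics (of FILE E and of ★★★).

0 `def`, 0 `sorry`.  References: T. Bałaban, CMP **109** (1987) 249–301 [Balaban1987RG1] ((0.4) p.253, (1.11)–(1.13) p.262); CMP **98** (1985) 17–51 [Balaban1985Averaging]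
(Prop. 3 (121)–(125) p.36).
-/

noncomputable section

open scoped BigOperators Matrix.Norms.L2Operator

namespace YMDAG.N18.TransportOfRecord

open Complex (I)
open NormedSpace (exp)
open Literature.MathematicalPhysics.QuantumFieldTheory.Balaban1983to89
open Literature.MathematicalPhysics.QuantumFieldTheory.Balaban1983to89.T4Continuum
open Literature.MathematicalPhysics.QuantumFieldTheory.Balaban1983to89.T4LevelShift
open Literature.MathematicalPhysics.QuantumFieldTheory.Balaban1983to89.BlockAveraging
open Literature.MathematicalPhysics.QuantumFieldTheory.Balaban1983to89.B12RegularSpaces111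
open Literature.MathematicalPhysics.QuantumFieldTheory.Balaban1983to89.B12RegularSpaces111SpecialUnitary (suModel mem_suModel_G mem_suModel_Gc mem_suModel_gc
  suModel_norm_le suModel_G_le_Gc)
open Literature.MathematicalPhysics.QuantumFieldTheory.Balaban1983to89.B7Prop1Explicit (U1 mem_U1)
open Literature.MathematicalPhysics.QuantumFieldTheory.Balaban1983to89.ExpMeanLog (eml expMeanLogSU deltaSU)
open Literature.MathematicalPhysics.QuantumFieldTheory.Balaban1983to89.MatrixLog (mlog exp_mlog norm_mlog_le_two_mul)
open Literature.MathematicalPhysics.QuantumFieldTheory.Balaban1983to89.Node00 (MatA ιSU coe_ιSU ιSU_mem_G)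
open Literature.MathematicalPhysics.QuantumFieldTheory.Balaban1983to89.Node00.W1
open Literature.MathematicalPhysics.QuantumFieldTheory.Balaban1983to89.Node00.Sect2 (regionOfSet domSys domSites frameI cubesI)
open Summit.QuantumFields.YangMills.Theorems.Prop8Chart (emlAvgU_congr₂ holT_loopWord_congr₂)
open YMDAG.N18.BoxStokes (norm_loopVarU_sub_one_le_quarter)

/-! ## §3 At the frames of record: the factorisation of the transported pair over the averaged factor -/

section Record

variable {F : T4Family} {N k : ℕ} [NeZero N]

/-- ★★★ **THE C⁰ FACTORISATION OF THE TRANSPORTED PAIR OVER THE AVERAGED FACTOR AT THE FRAMES OF RECORD.**  Let `Y ∈ 𝐃_j` of run A, `Φ` a pair of run B with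
`Φ.U = (exp iξA′)·U`, (i) for `U` at `α₀` and (ii) for `A′` at `α₁` on `frameI Rz M (j+1) (domSites π(j,Y))` (constants `cB`), and `ξ′ > 0`.  Under the displayed numerics
(`r + ((1+2ε)^ℓ − 1) ≤ 1∕2`, `r < δ_N`, `ρ := 22·(r + ((1+2ε)^ℓ − 1)) ≤ 1∕3`, `N·ρ < π`, and FILE B's `hUGc` numerics), there are `U_A, A′_A` with:
`Ū(b) = exp iξ′A′_A(b)·U_A(b)` at EVERY bond (`Ū = (TΦOfRecord F N k Φ).U`); on the bonds of `regionOfSet (domSites Y)`: `U_A(b) = fieldShift (avgUnits U)(b)`,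
`A′_A(b) = (iξ′)⁻¹ log(Ū(b)·U_A(b)⁻¹)`, `tr A′_A(b) = 0`, `‖A′_A(b)‖ ≤ 2ρ∕ξ′` (off them `U_A := Ū`, `A′_A := 0`). [cite: Balaban1985Averaging, Prop. 3 (121)-(123) p.36; Balaban1987RG1, (1.11)-(1.13) p.262] -/
theorem exists_factors_TΦOfRecord (Rz : Node00.Sect2.Residual (F.P (k + 1)) (MatA N)) (M j' : ℕ) (Y : (domSys (F.P k) M j').Dom)
    {cB : StepConsts} {α₀ α₁ γ₀ : ℝ} {Φ : FieldPair (F.P (k + 1)) 0 (MatA N)ˣ (MatA N)}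
    (hsat : SatisfiesI_III (suModel N) (frameI Rz M (j' + 1) (domSites (F.P (k + 1)) M (j' + 1) (pairOfRecord F M k ⟨j', Y⟩).2)) cB α₀ α₁ γ₀ Φ)
    {U : PBond (F.P (k + 1)) 0 → (MatA N)ˣ} {A' : PBond (F.P (k + 1)) 0 → MatA N} (hf : Factors cB Φ.U U A')
    (hI : CondI (suModel N) (frameI Rz M (j' + 1) (domSites (F.P (k + 1)) M (j' + 1) (pairOfRecord F M k ⟨j', Y⟩).2)) cB α₀ U)
    (hII : CondII (suModel N) (frameI Rz M (j' + 1) (domSites (F.P (k + 1)) M (j' + 1) (pairOfRecord F M k ⟨j', Y⟩).2)).X cB α₁ U A')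
    {ξA : ℝ} (hξA : 0 < ξA) (hξ : 0 ≤ cB.ξ) (hα₀ : 0 ≤ α₀) (hα₁ : 0 ≤ α₁) (hξ₁ : cB.ξ * α₁ ≤ 1 / 4)
    (hsm : (((((F.P (k + 1)).d + 2) * (F.P (k + 1)).L : ℕ) : ℝ) ^ 2 / 4) * (α₀ * cB.ξ ^ 2) +
        ((1 + 2 * (2 * (cB.ξ * α₁))) ^ (((F.P (k + 1)).d + 2) * (F.P (k + 1)).L) - 1) ≤ 1 / 2)
    (hguard : (((((F.P (k + 1)).d + 2) * (F.P (k + 1)).L : ℕ) : ℝ) ^ 2 / 4) * (α₀ * cB.ξ ^ 2) < deltaSU (Fin N))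
    (hρ3 : 22 * ((((((F.P (k + 1)).d + 2) * (F.P (k + 1)).L : ℕ) : ℝ) ^ 2 / 4) * (α₀ * cB.ξ ^ 2) +
        ((1 + 2 * (2 * (cB.ξ * α₁))) ^ (((F.P (k + 1)).d + 2) * (F.P (k + 1)).L) - 1)) ≤ 1 / 3)
    (hρπ : (N : ℝ) * (22 * ((((((F.P (k + 1)).d + 2) * (F.P (k + 1)).L : ℕ) : ℝ) ^ 2 / 4) * (α₀ * cB.ξ ^ 2) +
        ((1 + 2 * (2 * (cB.ξ * α₁))) ^ (((F.P (k + 1)).d + 2) * (F.P (k + 1)).L) - 1))) < Real.pi)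
    (h3 : (((((F.P (k + 1)).d + 2) * (F.P (k + 1)).L : ℕ) : ℝ) ^ 2 / 2) * (α₀ * cB.ξ ^ 2) +
        ((1 + 2 * (2 * (cB.ξ * α₁))) ^ (((F.P (k + 1)).d + 2) * (F.P (k + 1)).L) - 1) ≤ 1 / 3)
    (hπ : (N : ℝ) * ((((((F.P (k + 1)).d + 2) * (F.P (k + 1)).L : ℕ) : ℝ) ^ 2 / 2) * (α₀ * cB.ξ ^ 2) +
        ((1 + 2 * (2 * (cB.ξ * α₁))) ^ (((F.P (k + 1)).d + 2) * (F.P (k + 1)).L) - 1)) < Real.pi) :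
    ∃ (UA : PBond (F.P k) 0 → (MatA N)ˣ) (AA : PBond (F.P k) 0 → MatA N),
      (∀ b, (TΦOfRecord F N k Φ).U b = expI ξA (AA b) * UA b) ∧
      ∀ b ∈ (regionOfSet (F.P k) (domSites (F.P k) M j' Y)).bonds,
        UA b = fieldShift (sitesPerDir_ladder F (K := k) (j := 0) rfl rfl) (avgUnits U) b ∧
        AA b = (I * (ξA : ℂ))⁻¹ • mlog ((((TΦOfRecord F N k Φ).U b : (MatA N)ˣ) : MatA N) *
          (((fieldShift (sitesPerDir_ladder F (K := k) (j := 0) rfl rfl) (avgUnits U) b)⁻¹ : (MatA N)ˣ) : MatA N)) ∧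
        Matrix.trace (AA b) = 0 ∧
        ‖AA b‖ ≤ 2 * (22 * ((((((F.P (k + 1)).d + 2) * (F.P (k + 1)).L : ℕ) : ℝ) ^ 2 / 4) * (α₀ * cB.ξ ^ 2) +
          ((1 + 2 * (2 * (cB.ξ * α₁))) ^ (((F.P (k + 1)).d + 2) * (F.P (k + 1)).L) - 1))) / ξA := by
  classical
  set ρ : ℝ := 22 * ((((((F.P (k + 1)).d + 2) * (F.P (k + 1)).L : ℕ) : ℝ) ^ 2 / 4) * (α₀ * cB.ξ ^ 2) +
    ((1 + 2 * (2 * (cB.ξ * α₁))) ^ (((F.P (k + 1)).d + 2) * (F.P (k + 1)).L) - 1)) with hρ_def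
  have hj : 0 + 1 ≤ (F.P (k + 1)).m + (F.P (k + 1)).K := by simp only [T4Family.P_m, T4Family.P_K]; omega
  have hX : (frameI Rz M (j' + 1) (domSites (F.P (k + 1)) M (j' + 1) (pairOfRecord F M k ⟨j', Y⟩).2)).X =
      regionOfSet (F.P (k + 1)) ((fun x => (siteShift (YMDAG.N18.TwoRunCubes.ladder F k)).symm (blockOf x)) ⁻¹' domSites (F.P k) M j' Y) := by
    show regionOfSet (F.P (k + 1)) (domSites (F.P (k + 1)) M (j' + 1) (pairOfRecord F M k ⟨j', Y⟩).2) = _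
    rw [YMDAG.N18.TwoRunCubes.domSites_pairOfRecord_eq_preimage]
  -- the quotient `X_b = Ū(b)·U_A(b)⁻¹` and its size on the frame bonds
  let W : PBond (F.P k) 0 → (MatA N)ˣ := (TΦOfRecord F N k Φ).U
  let V : PBond (F.P k) 0 → (MatA N)ˣ := fieldShift (sitesPerDir_ladder F (K := k) (j := 0) rfl rfl) (avgUnits U)
  have hXb : ∀ b ∈ (regionOfSet (F.P k) (domSites (F.P k) M j' Y)).bonds,
      ‖((W b : (MatA N)ˣ) : MatA N) * (((V b)⁻¹ : (MatA N)ˣ) : MatA N) - 1‖ ≤ ρ := by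
    rintro ⟨y, μ⟩ hb
    show ‖((avgUnits Φ.U _ : (MatA N)ˣ) : MatA N) * (((avgUnits U _)⁻¹ : (MatA N)ˣ) : MatA N) - 1‖ ≤ ρ
    refine norm_avgUnits_mul_inv_sub_one_le hj hf hI hII _ (fun b' h1 h2 => ?_) (fun q h1 h2 h3 h4 => ?_) hξ hα₀ hα₁ hξ₁ hsm hguard
    · rw [hX]; exact YMDAG.N18.AvgPotential.twoBlocks_subset_bonds_preimage F k _ hb b' h1 h2
    · rw [hX]; exact twoBlocks_subset_plaqs_preimage _ hb q h1 h2 h3 h4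
  -- the witnesses
  refine ⟨fun b => if ‖((W b : (MatA N)ˣ) : MatA N) * (((V b)⁻¹ : (MatA N)ˣ) : MatA N) - 1‖ < 1 then V b else W b,
    fun b => if ‖((W b : (MatA N)ˣ) : MatA N) * (((V b)⁻¹ : (MatA N)ˣ) : MatA N) - 1‖ < 1 then
      (I * (ξA : ℂ))⁻¹ • mlog (((W b : (MatA N)ˣ) : MatA N) * (((V b)⁻¹ : (MatA N)ˣ) : MatA N)) else 0, fun b => ?_, fun b hb => ?_⟩
  · by_cases hlt : ‖((W b : (MatA N)ˣ) : MatA N) * (((V b)⁻¹ : (MatA N)ˣ) : MatA N) - 1‖ < 1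
    · simp only [if_pos hlt]
      exact (expI_log_mul_eq hξA.ne' (W b) (V b) hlt).symm
    · simp only [if_neg hlt]
      refine Units.ext ?_
      rw [Units.val_mul, B12Lemma4Concrete.val_expI, smul_zero, NormedSpace.exp_zero, one_mul]
  · have hρb := hXb b hb
    have hlt : ‖((W b : (MatA N)ˣ) : MatA N) * (((V b)⁻¹ : (MatA N)ˣ) : MatA N) - 1‖ < 1 := lt_of_le_of_lt hρb (hρ3.trans_lt (by norm_num))
    simp only [if_pos hlt]
    refine ⟨rfl, rfl, ?_, norm_log_div_le hξA hρb (hρ3.trans (by norm_num))⟩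
    -- tracelessness: both determinants are `1`
    have hWdet : Matrix.det ((W b : (MatA N)ˣ) : MatA N) = 1 :=
      mem_suModel_Gc.mp (TΦOfRecord_U_mem_suModel_Gc_of_satisfiesI_III_frameBond Rz M j' Y hsat b hb hξ hα₀ hα₁ hξ₁ h3 hπ)
    have hVdet : Matrix.det ((V b : (MatA N)ˣ) : MatA N) = 1 :=
      mem_suModel_Gc.mp (suModel_G_le_Gc (fieldShift_avgUnits_factor_mem_G_frameBond Rz M j' Y hI hα₀ hguard b hb))
    exact trace_log_eq_zero ξA (W b) (V b) hWdet hVdet (hρb.trans hρ3) (lt_of_le_of_lt (mul_le_mul_of_nonneg_left hρb (Nat.cast_nonneg N)) hρπ)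

/-- ★★★★ **`Factors ∧ CondI ∧ (A′ ∈ 𝔤ᶜ) ∧ (|A′| ≤ a)` FOR THE TRANSPORTED PAIR AT RUN A's FRAME OF RECORD** — the first block of FILE 7's `hletters` for the candidate
factor: with `cA.ξ = L·ξ_B = η_j` (`StepConsts.ofParams`), the witnesses `U_A, A′_A` of ★★★ satisfy `Factors (StepConsts.ofParams (F.P k) cA j) Ū U_A A′_A`,
`CondI (suModel N) (frameI RzA M j (domSites Y)) (StepConsts.ofParams (F.P k) cA j) α₀A U_A` (FILE E, transferred along `U_A = fieldShift (avgUnits U)` on the region's bonds),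
`A′_A(b) ∈ 𝔰𝔩(N, ℂ)` and `‖A′_A(b)‖ ≤ 2ρ∕η_j` on the frame bonds, and the CRUDE derivative letter `‖∇^{η_j}_{U_A} A′_A‖ ≤ 2·(2ρ∕η_j)∕η_j` on the frame's stencils
(`norm_nabla_le_two_mul_div`; the C¹ letter of [Balaban1985Averaging] Prop. 3 would give `O(α₁)`), under the displayed numerics of ★★★ and of FILE E. [cite: Balaban1987RG1, (1.11)-(1.13) p.262; Balaban1985Averaging, Prop. 3 p.36] -/
theorem exists_factors_condI_TΦOfRecord (Rz : Node00.Sect2.Residual (F.P (k + 1)) (MatA N)) (RzA : Node00.Sect2.Residual (F.P k) (MatA N)) (M j' : ℕ)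
    (Y : (domSys (F.P k) M j').Dom) {cB cA α₀ α₁ γ₀ α₀A : ℝ} {Φ : FieldPair (F.P (k + 1)) 0 (MatA N)ˣ (MatA N)}
    (hsat : SatisfiesI_III (suModel N) (frameI Rz M (j' + 1) (domSites (F.P (k + 1)) M (j' + 1) (pairOfRecord F M k ⟨j', Y⟩).2))
      (StepConsts.ofParams (F.P (k + 1)) cB (j' + 1)) α₀ α₁ γ₀ Φ)
    {U : PBond (F.P (k + 1)) 0 → (MatA N)ˣ} {A' : PBond (F.P (k + 1)) 0 → MatA N} (hf : Factors (StepConsts.ofParams (F.P (k + 1)) cB (j' + 1)) Φ.U U A')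
    (hI : CondI (suModel N) (frameI Rz M (j' + 1) (domSites (F.P (k + 1)) M (j' + 1) (pairOfRecord F M k ⟨j', Y⟩).2))
      (StepConsts.ofParams (F.P (k + 1)) cB (j' + 1)) α₀ U)
    (hII : CondII (suModel N) (frameI Rz M (j' + 1) (domSites (F.P (k + 1)) M (j' + 1) (pairOfRecord F M k ⟨j', Y⟩).2)).X
      (StepConsts.ofParams (F.P (k + 1)) cB (j' + 1)) α₁ U A')
    (hα₀ : 0 ≤ α₀) (hα₁ : 0 ≤ α₁) (ht : 0 ≤ cB * α₀) (hξ₁ : (F.P (k + 1)).eta (j' + 1) * α₁ ≤ 1 / 4)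
    (hsm : (((((F.P (k + 1)).d + 2) * (F.P (k + 1)).L : ℕ) : ℝ) ^ 2 / 4) * (α₀ * (F.P (k + 1)).eta (j' + 1) ^ 2) +
        ((1 + 2 * (2 * ((F.P (k + 1)).eta (j' + 1) * α₁))) ^ (((F.P (k + 1)).d + 2) * (F.P (k + 1)).L) - 1) ≤ 1 / 2)
    (hguard2 : (((((F.P (k + 1)).d + 2) * (F.P (k + 1)).L : ℕ) : ℝ) ^ 2 / 4) * (α₀ * (F.P (k + 1)).eta (j' + 1) ^ 2) < deltaSU (Fin N))
    (hguard4 : (((((F.P (k + 1)).d + 4) * (F.P (k + 1)).L : ℕ) : ℝ) ^ 2 / 4) * (α₀ * (F.P (k + 1)).eta (j' + 1) ^ 2) ≤ deltaSU (Fin N) / 2)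
    (hρ3 : 22 * ((((((F.P (k + 1)).d + 2) * (F.P (k + 1)).L : ℕ) : ℝ) ^ 2 / 4) * (α₀ * (F.P (k + 1)).eta (j' + 1) ^ 2) +
        ((1 + 2 * (2 * ((F.P (k + 1)).eta (j' + 1) * α₁))) ^ (((F.P (k + 1)).d + 2) * (F.P (k + 1)).L) - 1)) ≤ 1 / 3)
    (hρπ : (N : ℝ) * (22 * ((((((F.P (k + 1)).d + 2) * (F.P (k + 1)).L : ℕ) : ℝ) ^ 2 / 4) * (α₀ * (F.P (k + 1)).eta (j' + 1) ^ 2) +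
        ((1 + 2 * (2 * ((F.P (k + 1)).eta (j' + 1) * α₁))) ^ (((F.P (k + 1)).d + 2) * (F.P (k + 1)).L) - 1))) < Real.pi)
    (h3 : (((((F.P (k + 1)).d + 2) * (F.P (k + 1)).L : ℕ) : ℝ) ^ 2 / 2) * (α₀ * (F.P (k + 1)).eta (j' + 1) ^ 2) +
        ((1 + 2 * (2 * ((F.P (k + 1)).eta (j' + 1) * α₁))) ^ (((F.P (k + 1)).d + 2) * (F.P (k + 1)).L) - 1) ≤ 1 / 3)
    (hπ : (N : ℝ) * ((((((F.P (k + 1)).d + 2) * (F.P (k + 1)).L : ℕ) : ℝ) ^ 2 / 2) * (α₀ * (F.P (k + 1)).eta (j' + 1) ^ 2) +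
        ((1 + 2 * (2 * ((F.P (k + 1)).eta (j' + 1) * α₁))) ^ (((F.P (k + 1)).d + 2) * (F.P (k + 1)).L) - 1)) < Real.pi)
    (hplaq : ((F.P (k + 1)).L : ℝ) ^ 2 * (α₀ * (F.P (k + 1)).eta (j' + 1) ^ 2) +
        143 * ((((((F.P (k + 1)).d + 4) * (F.P (k + 1)).L : ℕ) : ℝ) ^ 2 / 4) * (α₀ * (F.P (k + 1)).eta (j' + 1) ^ 2)) ^ 2 < α₀A * (F.P k).eta j' ^ 2)
    (h48 : 48 * (((((F.P (k + 1)).d + 2) * (F.P (k + 1)).L : ℕ) : ℝ) * ((F.P (k + 1)).eta (j' + 1) * (cB * α₀))) ≤ 1)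
    (hN : 4 * (((((F.P (k + 1)).d + 2) * (F.P (k + 1)).L : ℕ) : ℝ) * ((F.P (k + 1)).eta (j' + 1) * (cB * α₀))) < deltaSU (Fin N))
    (hπc : (N : ℝ) * (2 * ((F.P (k + 1)).eta (j' + 1) * (cB * α₀))) < Real.pi)
    (h1 : ((F.P (k + 1)).L : ℝ) * (cB * α₀) + 3200 * (((((F.P (k + 1)).d + 2) * (F.P (k + 1)).L : ℕ) : ℝ)) ^ 2 * (F.P (k + 1)).eta (j' + 1) * (cB * α₀) ^ 2 <
      (F.P (k + 1)).L * (cA * α₀A)) :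
    ∃ (UA : PBond (F.P k) 0 → (MatA N)ˣ) (AA : PBond (F.P k) 0 → MatA N),
      Factors (StepConsts.ofParams (F.P k) cA j') (TΦOfRecord F N k Φ).U UA AA ∧
      CondI (suModel N) (frameI RzA M j' (domSites (F.P k) M j' Y)) (StepConsts.ofParams (F.P k) cA j') α₀A UA ∧
      (∀ b ∈ (frameI RzA M j' (domSites (F.P k) M j' Y)).X.bonds,
        UA b = fieldShift (sitesPerDir_ladder F (K := k) (j := 0) rfl rfl) (avgUnits U) b ∧
        AA b = (I * ((F.P k).eta j' : ℂ))⁻¹ • mlog ((((TΦOfRecord F N k Φ).U b : (MatA N)ˣ) : MatA N) *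
          (((fieldShift (sitesPerDir_ladder F (K := k) (j := 0) rfl rfl) (avgUnits U) b)⁻¹ : (MatA N)ˣ) : MatA N))) ∧
      (∀ b ∈ (frameI RzA M j' (domSites (F.P k) M j' Y)).X.bonds, AA b ∈ (suModel N).gc) ∧
      (∀ b ∈ (frameI RzA M j' (domSites (F.P k) M j' Y)).X.bonds,
        ‖AA b‖ ≤ 2 * (22 * ((((((F.P (k + 1)).d + 2) * (F.P (k + 1)).L : ℕ) : ℝ) ^ 2 / 4) * (α₀ * (F.P (k + 1)).eta (j' + 1) ^ 2) +
          ((1 + 2 * (2 * ((F.P (k + 1)).eta (j' + 1) * α₁))) ^ (((F.P (k + 1)).d + 2) * (F.P (k + 1)).L) - 1))) / (F.P k).eta j') ∧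
      ∀ q ∈ (frameI RzA M j' (domSites (F.P k) M j' Y)).X.dpairs,
        ‖nabla ((StepConsts.ofParams (F.P k) cA j').ξ) UA q.2.1 (fun y => AA ⟨y, q.2.2⟩) q.1‖ ≤
          2 * (2 * (22 * ((((((F.P (k + 1)).d + 2) * (F.P (k + 1)).L : ℕ) : ℝ) ^ 2 / 4) * (α₀ * (F.P (k + 1)).eta (j' + 1) ^ 2) +
            ((1 + 2 * (2 * ((F.P (k + 1)).eta (j' + 1) * α₁))) ^ (((F.P (k + 1)).d + 2) * (F.P (k + 1)).L) - 1))) / (F.P k).eta j') / (F.P k).eta j' := by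
  have hξA : 0 < (F.P k).eta j' := pow_pos (inv_pos.mpr (Nat.cast_pos.mpr (F.P k).L_pos)) _
  have hξB0 : 0 ≤ (StepConsts.ofParams (F.P (k + 1)) cB (j' + 1)).ξ := by
    show 0 ≤ (F.P (k + 1)).eta (j' + 1)
    exact (pow_pos (inv_pos.mpr (Nat.cast_pos.mpr (F.P (k + 1)).L_pos)) _).le
  obtain ⟨UA, AA, hfac, hrest⟩ := exists_factors_TΦOfRecord Rz M j' Y hsat hf hI hII hξA hξB0 hα₀ hα₁ hξ₁ hsm hguard2 hρ3 hρπ h3 hπ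
  have hcondI := condI_fieldShift_avgUnits_factor Rz RzA M j' Y hI hα₀ ht hguard2 hguard4 hplaq h48 hN hπc h1
  have hcondI' := condI_congr_frameI RzA M j' _ (fun b hb => ((hrest b hb).1).symm) hcondI
  refine ⟨UA, AA, hfac, hcondI', fun b hb => ⟨(hrest b hb).1, (hrest b hb).2.1⟩, fun b hb => ?_, fun b hb => (hrest b hb).2.2.2, fun q hq => ?_⟩
  · exact mem_suModel_gc.mpr (hrest b hb).2.2.1
  · obtain ⟨h0, hμ, hν, hμν⟩ := hq
    have hbμ : (⟨q.1, q.2.1⟩ : PBond (F.P k) 0) ∈ (frameI RzA M j' (domSites (F.P k) M j' Y)).X.bonds := ⟨h0, hμ⟩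
    have hbν : (⟨q.1, q.2.2⟩ : PBond (F.P k) 0) ∈ (frameI RzA M j' (domSites (F.P k) M j' Y)).X.bonds := ⟨h0, hν⟩
    have hbμν : (⟨q.1.shift q.2.1, q.2.2⟩ : PBond (F.P k) 0) ∈ (frameI RzA M j' (domSites (F.P k) M j' Y)).X.bonds := ⟨hμ, hμν⟩
    have hG := hcondI'.gValued _ hbμ
    exact norm_nabla_le_two_mul_div hξA q.1 q.2.1 q.2.2 (suModel_norm_le _ hG) (suModel_norm_le _ ((suModel N).G.inv_mem hG)) (hrest _ hbμν).2.2.2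
      (hrest _ hbν).2.2.2

end Record

end YMDAG.N18.TransportOfRecord

end
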